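import Literature.Topology.PlaneTopology.ChartCrossingJump
import Literature.Topology.PlaneTopology.WindingReparam
import Literature.Topology.PlaneTopology.Rectangles
import Literature.Topology.PlaneTopology.ChartParity
import Literature.Topology.PlaneTopology.JordanSweepParity
import Literature.Topology.PlaneTopology.RectangleDuality
import HarnessLib

/-!
# The winding numbers of a closed curve with a chart-straight piece jump across it

Topic: Topology / PlaneTopology, sequel to `ChartCrossingJump.lean` (the jump of the winding
number across a boundary arc of a Jordan domain read in a chart), `WindingReparam.lean`,
`Rectangles.lean`, `ChartParity.lean` (`cplxInv ι e = ι ∘ e.symm`, a chart of a plane domain read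
in the plane). A continuous `1`-periodic curve `ω : ℝ → ℂ` has a **straight piece** in the chart
`e` (`StraightPiece`): on `[t₁, t₂]` it is the image of the horizontal chart segment
`[b₁, b₂] × {h₀}`, and the rest `ω([t₂, t₁ + 1])` avoids the image of the open chart box
`(b₁, b₂) × (h₀ - r, h₀ + r)`. Then for `0 < ρ < r` and `c = (b₁ + b₂)/2`, **the winding numbers
of `ω` about the two points `p₋ = ι e⁻¹(c, h₀ - ρ)`, `p₊ = ι e⁻¹(c, h₀ + ρ)` differ by `±1`**
(`StraightPiece.wind_sub_wind`): rotate the parameter so that the straight piece comes first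
(`wind_eq_wind_concatPath_subarc`), recognise it as the bottom side of the chart rectangle
`(b₁, b₂) × (h₀, h₀ + r)` read through `cplxInv ι e`, and apply `wind_sub_wind_concatPath_chart`
with the vertical segment from `(c, h₀ - ρ)` to `(c, h₀ + ρ)`. Also: `p₊`, `p₋` are off the curve
(`StraightPiece.ne_pt`). Used for the planar traces of closed walks of separatrix graphs.

All statements are [folklore].
-/

noncomputable section

open Set Function Complex Metric
open _root_.Topology

namespace Literature.Topology.PlaneTopology

variable {X : Type*} [TopologicalSpace X] {ι : X → ℂ} {e : OpenPartialHomeomorph X (ℝ × ℝ)} {ω : ℝ → ℂ}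

/-- **A chart-straight piece of a closed curve**: on `[t₁, t₂] ⊆ [0, 1]` the curve `ω` is the
image of the horizontal chart segment `[b₁, b₂] × {h₀}` of the chart `e` (read in the plane through
`ι`), and on the complementary arc `[t₂, t₁ + 1]` it avoids the image of the open chart box
`(b₁, b₂) × (h₀ - r, h₀ + r)`. [folklore] -/
structure StraightPiece (ι : X → ℂ) (e : OpenPartialHomeomorph X (ℝ × ℝ)) (ω : ℝ → ℂ) where
  /-- The parameter interval of the piece. -/
  t₁ : ℝ
  /-- The parameter interval of the piece. -/
  t₂ : ℝ
  /-- The chart abscissae of the piece. -/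
  b₁ : ℝ
  /-- The chart abscissae of the piece. -/
  b₂ : ℝ
  /-- The chart height of the piece. -/
  h₀ : ℝ
  /-- The height radius of the avoided box. -/
  r : ℝ
  ht₁ : 0 ≤ t₁
  ht₁₂ : t₁ < t₂
  ht₂ : t₂ ≤ 1
  hb : b₁ < b₂
  hr : 0 < r
  straight : ∀ u ∈ Icc (0 : ℝ) 1, ω (t₁ + u * (t₂ - t₁)) = ι (e.symm (b₁ + u * (b₂ - b₁), h₀))
  away : ∀ t ∈ Icc t₂ (t₁ + 1), ω t ∉ (fun q : ℝ × ℝ ↦ ι (e.symm q)) '' (Ioo b₁ b₂ ×ˢ Ioo (h₀ - r) (h₀ + r))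

namespace StraightPiece

variable (P : StraightPiece ι e ω)

/-- The abscissa of the two test points. [folklore] -/
def c : ℝ := (P.b₁ + P.b₂) / 2

/-- The test point `ι e⁻¹(c, h₀ + ρ)`. [folklore] -/
def pt (ρ : ℝ) : ℂ := ι (e.symm (P.c, P.h₀ + ρ))

/-- The abscissa is strictly between `b₁` and `b₂`. [folklore] -/
theorem c_mem : P.c ∈ Ioo P.b₁ P.b₂ := by
  have := P.hb
  simp only [c, mem_Ioo]
  exact ⟨by linarith, by linarith⟩

/-- **The test points at heights `h₀ ± ρ`, `0 < |ρ| < r`, are off the curve.** [folklore] -/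
theorem ne_pt (hι : Injective ι) (he : e.target = univ) (hωp : Periodic ω 1) {ρ : ℝ} (hρ0 : ρ ≠ 0) (hρ : |ρ| < P.r)
    (t : ℝ) : ω t ≠ P.pt ρ := by
  have hsymm_inj : ∀ {q q' : ℝ × ℝ}, ι (e.symm q) = ι (e.symm q') → q = q' := fun {q q'} h ↦ by
    have h' := hι h
    have hq : q ∈ e.target := by rw [he]; exact mem_univ _
    have hq' : q' ∈ e.target := by rw [he]; exact mem_univ _
    rw [← e.right_inv hq, ← e.right_inv hq', h']
  -- reduce `t` to the period `[t₁, t₁ + 1]`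
  have hd : 0 < P.t₂ - P.t₁ := sub_pos.2 P.ht₁₂
  set k := ⌊t - P.t₁⌋ with hk
  set t' := t - k with ht'
  have ht'eq : ω t = ω t' := by
    rw [ht']
    have := hωp.sub_int_mul_eq k (x := t)
    rw [mul_one] at this
    exact this.symm
  have hk1 : (k : ℝ) ≤ t - P.t₁ := Int.floor_le _
  have hk2 : t - P.t₁ < k + 1 := Int.lt_floor_add_one _
  have ht'mem : t' ∈ Icc P.t₁ (P.t₁ + 1) := ⟨by rw [ht']; linarith, by rw [ht']; linarith⟩
  rw [ht'eq]
  intro hω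
  rcases le_or_gt t' P.t₂ with hle | hgt
  · -- on the straight piece
    set u := (t' - P.t₁) / (P.t₂ - P.t₁) with hu
    have hu01 : u ∈ Icc (0 : ℝ) 1 := ⟨div_nonneg (by linarith [ht'mem.1]) hd.le, (div_le_one hd).2 (by linarith)⟩
    have ht'u : t' = P.t₁ + u * (P.t₂ - P.t₁) := by rw [hu]; field_simp; ring
    rw [ht'u, P.straight u hu01, pt] at hω
    have := congrArg Prod.snd (hsymm_inj hω)
    simp only at this
    exact hρ0 (by linarith)
  · -- on the rest: the test point is in the avoided box
    have hmem : t' ∈ Icc P.t₂ (P.t₁ + 1) := ⟨hgt.le, ht'mem.2⟩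
    exact P.away t' hmem ⟨(P.c, P.h₀ + ρ), ⟨P.c_mem, by linarith [neg_abs_le ρ], by linarith [le_abs_self ρ]⟩, hω.symm ▸ rfl⟩

/-- The chart read in the plane on a point with given coordinates. [folklore] -/
theorem cplxInv_ofReal_add_mul_I (x y : ℝ) : cplxInv ι e ((x : ℂ) + (y : ℂ) * I) = ι (e.symm (x, y)) := by
  rw [cplxInv, toRR_apply]
  congr 2; simp

/-- **The winding numbers about the two test points differ by `±1`.** [folklore] -/
theorem wind_sub_wind (hι : IsOpenEmbedding ι) (he : e.target = univ) (hωc : Continuous ω) (hωp : Periodic ω 1)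
    {ρ : ℝ} (hρ : ρ ∈ Ioo 0 P.r) :
    wind (fun t ↦ ω t - P.pt (-ρ)) - wind (fun t ↦ ω t - P.pt ρ) = 1 ∨
      wind (fun t ↦ ω t - P.pt (-ρ)) - wind (fun t ↦ ω t - P.pt ρ) = -1 := by
  -- the chart read in the plane and the chart rectangle above the piece
  set ψ := cplxInv ι e with hψ
  have hψc : Continuous ψ := continuous_cplxInv hι.continuous he
  have hψi : Injective ψ := injective_cplxInv hι.injective he
  have hψo : IsOpenMap ψ := isOpenMap_cplxInv hι he
  have hb := P.hb
  have hr := P.hr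
  have hd' : P.h₀ < P.h₀ + P.r := by linarith
  set D := rect hb hd' with hD
  have hj : QuadJunction (seg (P.b₁ + P.h₀ * I) (P.b₂ + P.h₀ * I)) (seg (P.b₂ + P.h₀ * I) (P.b₂ + (P.h₀ + P.r) * I))
      (seg (P.b₂ + (P.h₀ + P.r) * I) (P.b₁ + (P.h₀ + P.r) * I)) (seg (P.b₁ + (P.h₀ + P.r) * I) (P.b₁ + P.h₀ * I)) :=
    ⟨by simp, by simp, by simp, by simp⟩
  have hbdy : ∀ t, D.boundary t = quadLoop (seg (P.b₁ + P.h₀ * I) (P.b₂ + P.h₀ * I)) (seg (P.b₂ + P.h₀ * I) (P.b₂ + (P.h₀ + P.r) * I))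
      (seg (P.b₂ + (P.h₀ + P.r) * I) (P.b₁ + (P.h₀ + P.r) * I)) (seg (P.b₁ + (P.h₀ + P.r) * I) (P.b₁ + P.h₀ * I)) t := fun t ↦ by
    rw [hD, rect]; push_cast; rfl
  -- the straight piece read through `ψ`
  have hseg : ∀ u : ℝ, ψ (seg (P.b₁ + P.h₀ * I) (P.b₂ + P.h₀ * I) u) = ι (e.symm (P.b₁ + u * (P.b₂ - P.b₁), P.h₀)) := fun u ↦ by
    obtain ⟨hre, him⟩ := seg_re_im ((P.b₁ : ℂ) + P.h₀ * I) (P.b₂ + P.h₀ * I) u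
    rw [hψ, cplxInv, toRR_apply, hre, him]
    congr 2; simp
  -- the two test points read through `ψ`
  set qi : ℂ := (P.c : ℂ) + ((P.h₀ + ρ : ℝ) : ℂ) * I with hqi
  set qo : ℂ := (P.c : ℂ) + ((P.h₀ - ρ : ℝ) : ℂ) * I with hqo
  have hψqi : ψ qi = P.pt ρ := by rw [hqi, hψ, cplxInv_ofReal_add_mul_I]; rfl
  have hψqo : ψ qo = P.pt (-ρ) := by rw [hqo, hψ, cplxInv_ofReal_add_mul_I, pt, ← sub_eq_add_neg]
  have hqi_re : qi.re = P.c := by simp [hqi]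
  have hqi_im : qi.im = P.h₀ + ρ := by simp [hqi]
  have hqo_re : qo.re = P.c := by simp [hqo]
  have hqo_im : qo.im = P.h₀ - ρ := by simp [hqo]
  have hRcoord : ∀ s : ℝ, toRR (seg qo qi s) = (P.c, P.h₀ - ρ + s * (2 * ρ)) := fun s ↦ by
    obtain ⟨hRre, hRim⟩ := seg_re_im qo qi s
    rw [toRR_apply, hRre, hRim, hqo_re, hqi_re, hqo_im, hqi_im]
    simp only [Prod.mk.injEq]
    exact ⟨by ring, by ring⟩
  have hψR : ∀ s : ℝ, ψ (seg qo qi s) = ι (e.symm (P.c, P.h₀ - ρ + s * (2 * ρ))) := fun s ↦ by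
    rw [hψ, cplxInv, hRcoord]
  obtain ⟨hc₁, hc₂⟩ := P.c_mem
  have hqiD : qi ∈ D.carrier := by
    rw [hD, rect_carrier, mem_reProdIm, hqi_re, hqi_im]
    exact ⟨⟨hc₁, hc₂⟩, by linarith [hρ.1], by linarith [hρ.2]⟩
  have hqoD : qo ∉ closure D.carrier := by
    rw [hD, closure_rect_carrier, mem_reProdIm, hqo_im]
    rintro ⟨-, h1, -⟩
    linarith [hρ.1]
  -- the test points are off the curve
  have hne : ∀ (σ : ℝ), σ = ρ ∨ σ = -ρ → ∀ t, ω t - P.pt σ ≠ 0 := fun σ hσ t ↦ sub_ne_zero.2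
    (P.ne_pt hι.injective he hωp (by rcases hσ with rfl | rfl <;> [exact hρ.1.ne'; exact neg_ne_zero.2 hρ.1.ne'])
      (by rcases hσ with rfl | rfl <;> simp [abs_of_pos hρ.1, hρ.2]) t)
  -- Step 1: rotate so that the straight piece is the head
  have hd : 0 < P.t₂ - P.t₁ := sub_pos.2 P.ht₁₂
  have h21 : P.t₂ ≤ P.t₁ + 1 := by linarith [P.ht₂, P.ht₁]
  set A : ℝ → ℂ := fun u ↦ ω (P.t₂ + u * (P.t₁ + 1 - P.t₂)) with hA
  have hrot : ∀ (σ : ℝ), σ = ρ ∨ σ = -ρ →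
      wind (fun t ↦ ω t - P.pt σ) = wind (fun t ↦ concatPath (headPath ψ D (1 / 4)) A t - P.pt σ) := by
    intro σ hσ
    rw [wind_eq_wind_concatPath_subarc (W := fun t ↦ ω t - P.pt σ) (hωc.sub continuous_const) (fun t ↦ by simp [hωp t])
      (hne σ hσ) P.ht₁₂ h21]
    refine wind_congr fun t ht ↦ ?_
    rcases le_or_gt t (1 / 2) with h | h
    · rw [concatPath_of_le_half h, concatPath_of_le_half h, headPath]
      have h2t : 2 * t ∈ Icc (0 : ℝ) 1 := ⟨by linarith [ht.1], by linarith⟩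
      rw [P.straight (2 * t) h2t, hbdy, quadLoop_apply_of_mem_first hj ⟨by linarith [ht.1], by linarith⟩,
        show 4 * (1 / 4 * (2 * t)) = 2 * t by ring, hseg]
    · rw [concatPath_of_half_lt h, concatPath_of_half_lt h]
  rw [hrot ρ (Or.inl rfl), hrot (-ρ) (Or.inr rfl), ← hψqo, ← hψqi]
  -- Step 2: the crossing formula
  refine wind_sub_wind_concatPath_chart (D := D) hψc hψi hψo (by rw [hD, closure_rect_carrier]; exact convex_Icc_reProdIm_Icc _ _ _ _)
    ⟨by norm_num, by norm_num⟩ (A := A) ((hωc.comp (continuous_const.add (continuous_id.mul continuous_const))).continuousOn)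
    ?_ ?_ hqiD hqoD (R := seg qo qi) (continuous_seg _ _).continuousOn (seg_zero _ _) (seg_one _ _) ?_ ?_
  · -- `A 0 = ψ (∂D (1/4))`, the end of the straight piece
    show ω (P.t₂ + 0 * (P.t₁ + 1 - P.t₂)) = ψ (D.boundary (1 / 4))
    rw [zero_mul, add_zero, hbdy, quadLoop_apply_of_mem_first hj ⟨by norm_num, le_rfl⟩, show (4 : ℝ) * (1 / 4) = 1 by norm_num,
      hseg, show P.t₂ = P.t₁ + 1 * (P.t₂ - P.t₁) by ring, P.straight 1 ⟨zero_le_one, le_rfl⟩]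
  · -- `A 1 = ψ (∂D 0)`, the start of the straight piece
    show ω (P.t₂ + 1 * (P.t₁ + 1 - P.t₂)) = ψ (D.boundary 0)
    have h1 : P.t₂ + 1 * (P.t₁ + 1 - P.t₂) = P.t₁ + 1 := by ring
    have h3 : ω P.t₁ = ι (e.symm (P.b₁, P.h₀)) := by
      have := P.straight 0 ⟨le_rfl, zero_le_one⟩
      simp only [zero_mul, add_zero] at this
      exact this
    rw [h1, hωp P.t₁, h3, hbdy, quadLoop_zero hj, hseg]
    simp
  · -- the vertical segment misses the three other sides
    intro s hs t ht hst
    have hRre' : (seg qo qi s).re = P.c := congrArg Prod.fst (hRcoord s)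
    have hRim' : (seg qo qi s).im ≤ P.h₀ + ρ := by
      rw [show (seg qo qi s).im = P.h₀ - ρ + s * (2 * ρ) from congrArg Prod.snd (hRcoord s)]
      nlinarith [hs.1, hs.2, hρ.1]
    rw [hst, hbdy] at hRre' hRim'
    rcases le_or_gt t (1 / 2) with h₁ | h₁
    · -- right side: `re = b₂`
      rw [quadLoop_apply_of_mem_second hj ⟨ht.1, h₁⟩, (seg_re_im _ _ _).1] at hRre'
      simp at hRre'
      linarith
    rcases le_or_gt t (3 / 4) with h₂ | h₂
    · -- top side: `im = h₀ + r`
      rw [quadLoop_apply_of_mem_third hj ⟨h₁.le, h₂⟩, (seg_re_im _ _ _).2] at hRim'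
      simp at hRim'
      linarith [hρ.2]
    · -- left side: `re = b₁`
      rw [quadLoop_apply_of_mem_fourth hj ⟨h₂.le, ht.2⟩, (seg_re_im _ _ _).1] at hRre'
      simp at hRre'
      linarith
  · -- the rest of the curve misses `ψ ∘ R` (the avoided box)
    intro t ht s hs hAs
    have hmem : P.t₂ + t * (P.t₁ + 1 - P.t₂) ∈ Icc P.t₂ (P.t₁ + 1) :=
      ⟨by nlinarith [ht.1, h21], by nlinarith [ht.2, h21]⟩
    refine P.away _ hmem ⟨(P.c, P.h₀ - ρ + s * (2 * ρ)), ⟨⟨hc₁, hc₂⟩, ?_, ?_⟩, ?_⟩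
    · nlinarith [hs.1, hρ.1, hρ.2]
    · nlinarith [hs.2, hρ.1, hρ.2]
    · show ι (e.symm (P.c, P.h₀ - ρ + s * (2 * ρ))) = A t
      rw [hAs, hψR]

end StraightPiece

end Literature.Topology.PlaneTopology
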